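import Mathlib
import Literature.Probability.MarkovChains.TotalVariation
import Literature.Probability.Entropy.PinskerInequality
import Literature.InformationTheory.Entropy.GibbsInequality
import Summits.Ventures.LatticeQCDFlow.Scaling.ImportanceWeights
import Summits.Ventures.LatticeQCDFlow.Scaling.Pseudofermions

/-!
# LatticeQCDFlow / Scaling — KL chain rules, superadditivity (T2-H) and the block-defect volume
# law (T2-I)

HONEST FRAMING: exact (Metropolis-corrected) sampling algorithms for lattice gauge theory;
figures of merit are autocorrelation/cost numbers at stated couplings and volumes; no
continuum-physics claim.

Venture `LatticeQCDFlow` (cell pub-lqcd), topic `Scaling`, items T2-H and T2-I of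
HOME/THEORY-2.md §4 (the provable KL core of barrier B1 `VolumeScalingOfTraining`), landed by
FANOUT row 31 from `HOME/THEORY-2-Sketch.lean` (theory seat; v1.1 proofs, decls verbatim).
Finite state spaces; `klFin`, `prodLaw`, `blockProd` from `Scaling/ImportanceWeights.lean`,
`margU` from `Scaling/Pseudofermions.lean`, `tvDist` from the tree's `TotalVariation.lean`, the
sharp Pinsker inequality `two_mul_tvDist_sq_le_kl` from `Literature/Probability/Entropy/`.

* `klFin_prodLaw_eq` — chain rule `D(r‖a⊗b) = D(r‖r₁⊗r₂) + D(r₁‖a) + D(r₂‖b)`;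
  `klFin_margU_add_klFin_margF_le` / `KLSuperadditiveFin` / `klSuperadditiveFin` (T2-H) —
  `D(r₁‖a) + D(r₂‖b) ≤ D(r‖a⊗b)`, the finite shadow of the tree theorem
  `Literature.MathematicalPhysics.StatisticalMechanics.klDiv_map_fst_add_klDiv_map_snd_le`;
* `blockMarg`, `klFin_blockProd_eq` (`m`-block chain rule), `blockDefect_volume_law` /
  `BlockDefectVolumeLaw` / `blockDefectVolumeLaw` (T2-I) — if the MODEL factorises over `m`
  blocks and every block marginal of the target is at total variation `≥ δ` from the model's
  factor, `D_KL(p‖q) ≥ 2 m δ²`; with T2-A, `ess_blockDefect_volume_law`: `ESS/N ≤ exp(−2 m δ²)` —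
  exponential in the number of blocks, i.e. in the volume at fixed block size.  The physics
  input "δ > 0 uniformly in the volume" is hypothesis (U)/(U′) of THEORY-2.md §3.1 (a theorem at
  strong coupling, conjectural at intermediate β; reduced to one connected correlator by
  `Scaling/CovDefect.lean`) — NOT asserted here.

The model-side independence across blocks is supplied by the light cone of a local flow
(`Scaling/LocalFlows.lean`, T2-G); the acceptance-rate analogue is `Scaling/Bhattacharyya.lean`.
-/

namespace Summit.Ventures.LatticeQCDFlow.Theory2

open Finset
open Literature.Probability.MarkovChains Literature.Probability.Entropy

variable {X : Type*} [Fintype X] {Y : Type*} [Fintype Y] [DecidableEq X]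

section KL

/-! ## Forward KL: Gibbs, chain rule over two blocks, superadditivity (T2-H) -/

omit [DecidableEq X] in
/-- Gibbs' inequality for `klFin` (tree: `sum_mul_log_div_nonneg`). [folklore] -/
theorem klFin_nonneg {p q : X → ℝ} (hp : ∀ x, 0 ≤ p x) (hq : ∀ x, 0 < q x)
    (h : ∑ x, p x = ∑ x, q x) : 0 ≤ klFin p q :=
  Literature.InformationTheory.Entropy.sum_mul_log_div_nonneg hp hq h

/-- Second marginal of a joint law on `U × F`. [folklore] -/
noncomputable def margF {U F : Type*} [Fintype U] (r : U × F → ℝ) : F → ℝ :=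
  fun f => ∑ u, r (u, f)

omit [DecidableEq X] in
/-- Marginalisation preserves total mass. [folklore] -/
theorem sum_margF (r : X × Y → ℝ) : ∑ y, margF r y = ∑ z, r z := by
  rw [Fintype.sum_prod_type_right]; rfl

omit [Fintype X] [DecidableEq X] in
/-- Marginals of a positive joint law are positive. [folklore] -/
theorem margU_pos {r : X × Y → ℝ} [Nonempty Y] (hr : ∀ z, 0 < r z) (x : X) : 0 < margU r x :=
  sum_pos (fun y _ => hr (x, y)) univ_nonempty

omit [Fintype Y] [DecidableEq X] in
/-- Marginals of a positive joint law are positive. [folklore] -/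
theorem margF_pos {r : X × Y → ℝ} [Nonempty X] (hr : ∀ z, 0 < r z) (y : Y) : 0 < margF r y :=
  sum_pos (fun x _ => hr (x, y)) univ_nonempty

omit [DecidableEq X] in
/-- **Chain rule of the forward KL against a product reference**:
`D(r ‖ a⊗b) = D(r ‖ r₁⊗r₂) + D(r₁ ‖ a) + D(r₂ ‖ b)` (mutual information + marginal divergences).
[folklore] -/
theorem klFin_prodLaw_eq [Nonempty X] [Nonempty Y] {r : X × Y → ℝ} {a : X → ℝ} {b : Y → ℝ}
    (hr : ∀ z, 0 < r z) (ha : ∀ x, 0 < a x) (hb : ∀ y, 0 < b y) :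
    klFin r (prodLaw a b) =
      klFin r (prodLaw (margU r) (margF r)) + klFin (margU r) a + klFin (margF r) b := by
  have h1 : ∀ z : X × Y, r z * Real.log (r z / prodLaw a b z) =
      r z * Real.log (r z / prodLaw (margU r) (margF r) z) +
        r z * Real.log (margU r z.1 / a z.1) + r z * Real.log (margF r z.2 / b z.2) := by
    intro z
    have hr1 : 0 < margU r z.1 := margU_pos hr z.1
    have hr2 : 0 < margF r z.2 := margF_pos hr z.2
    have hrz : 0 < r z := hr z
    have haz : 0 < a z.1 := ha z.1
    have hbz : 0 < b z.2 := hb z.2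
    have e : r z / prodLaw a b z =
        (r z / prodLaw (margU r) (margF r) z) * (margU r z.1 / a z.1) * (margF r z.2 / b z.2) := by
      unfold prodLaw
      field_simp
    have n1 : r z / prodLaw (margU r) (margF r) z * (margU r z.1 / a z.1) ≠ 0 :=
      (mul_pos (div_pos hrz (mul_pos hr1 hr2)) (div_pos hr1 haz)).ne'
    have n2 : margF r z.2 / b z.2 ≠ 0 := (div_pos hr2 hbz).ne'
    have n3 : r z / prodLaw (margU r) (margF r) z ≠ 0 := (div_pos hrz (mul_pos hr1 hr2)).ne'
    have n4 : margU r z.1 / a z.1 ≠ 0 := (div_pos hr1 haz).ne'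
    rw [e, Real.log_mul n1 n2, Real.log_mul n3 n4]
    ring
  unfold klFin
  rw [sum_congr rfl fun z _ => h1 z, sum_add_distrib, sum_add_distrib]
  congr 1
  · congr 1
    -- `Σ_z r z · g(z.1) = Σ_x r₁ x · g x`
    rw [Fintype.sum_prod_type]
    exact sum_congr rfl fun x _ => by dsimp only; rw [← sum_mul]; rfl
  · rw [Fintype.sum_prod_type_right]
    exact sum_congr rfl fun y _ => by dsimp only; rw [← sum_mul]; rfl

omit [DecidableEq X] in
/-- **T2-H (finite superadditivity of the forward KL w.r.t. a product reference).**
`D(r₁ ‖ a) + D(r₂ ‖ b) ≤ D(r ‖ a⊗b)`.  [folklore] -/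
theorem klFin_margU_add_klFin_margF_le [Nonempty X] [Nonempty Y] {r : X × Y → ℝ} {a : X → ℝ}
    {b : Y → ℝ} (hr : ∀ z, 0 < r z) (hr1 : ∑ z, r z = 1) (ha : ∀ x, 0 < a x)
    (hb : ∀ y, 0 < b y) :
    klFin (margU r) a + klFin (margF r) b ≤ klFin r (prodLaw a b) := by
  rw [klFin_prodLaw_eq hr ha hb]
  have hI : 0 ≤ klFin r (prodLaw (margU r) (margF r)) := by
    refine klFin_nonneg (fun z => (hr z).le)
      (fun z => mul_pos (margU_pos hr z.1) (margF_pos hr z.2)) ?_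
    rw [sum_prodLaw, hr1]
    have h1 : ∑ x, margU r x = 1 := by
      unfold margU; rw [← hr1, Fintype.sum_prod_type]
    have h2 : ∑ y, margF r y = 1 := by rw [sum_margF, hr1]
    rw [h1, h2, one_mul]
  linarith

/-- **T2-H (finite superadditivity of the forward KL w.r.t. a product reference) — PROVED
(`klSuperadditiveFin`); the finite shadow of the tree theorem
`Literature.MathematicalPhysics.StatisticalMechanics.klDiv_map_fst_add_klDiv_map_snd_le`.**
`D(r₁‖a) + D(r₂‖b) ≤ D(r‖a ⊗ b)` for a law `r` on `X × Y` with marginals `r₁, r₂`. [folklore] -/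
def KLSuperadditiveFin : Prop :=
  ∀ (X Y : Type) [Fintype X] [Fintype Y] (r : X × Y → ℝ) (a : X → ℝ) (b : Y → ℝ),
    (∀ z, 0 < r z) → ∑ z, r z = 1 → (∀ x, 0 < a x) → ∑ x, a x = 1 →
    (∀ y, 0 < b y) → ∑ y, b y = 1 →
    klFin (fun x => ∑ y, r (x, y)) a + klFin (fun y => ∑ x, r (x, y)) b ≤ klFin r (prodLaw a b)

/-- T2-H holds (`klFin_margU_add_klFin_margF_le`; the empty-type cases are vacuous). [folklore] -/
theorem klSuperadditiveFin : KLSuperadditiveFin := by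
  intro X Y _ _ r a b hr hr1 ha _ hb _
  cases isEmpty_or_nonempty X with
  | inl hX =>
    -- empty `X`: `Σ r = 0 ≠ 1`
    exfalso
    have : ∑ z : X × Y, r z = 0 := by
      rw [Fintype.sum_prod_type]; exact Fintype.sum_empty _
    linarith
  | inr hX =>
    cases isEmpty_or_nonempty Y with
    | inl hY =>
      exfalso
      have : ∑ z : X × Y, r z = 0 := by
        rw [Fintype.sum_prod_type_right]; exact Fintype.sum_empty _
      linarith
    | inr hY => exact klFin_margU_add_klFin_margF_le hr hr1 ha hb

end KL

/-! ## Many blocks: `D(p ‖ ⊗ qb) = D(p ‖ ⊗ p_i) + Σ_i D(p_i ‖ qb_i)` and the block-defect law (T2-I) -/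

section Blocks

variable {m : ℕ} {Z : Type*} [Fintype Z] [DecidableEq Z]

/-- Marginal of block `i` of a law on `Fin m → Z`. [folklore] -/
noncomputable def blockMarg (p : (Fin m → Z) → ℝ) (i : Fin m) : Z → ℝ :=
  fun z => ∑ φ ∈ univ.filter (fun φ => φ i = z), p φ

omit [DecidableEq Z] in
/-- Transfer of a one-block observable to the block marginal:
`Σ_φ p φ · g (φ i) = Σ_z p_i z · g z`. [folklore] -/
theorem sum_mul_apply_eq_sum_blockMarg [DecidableEq Z] (p : (Fin m → Z) → ℝ) (i : Fin m)
    (g : Z → ℝ) : ∑ φ, p φ * g (φ i) = ∑ z, blockMarg p i z * g z := by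
  rw [← sum_fiberwise univ (fun φ : Fin m → Z => φ i) (fun φ => p φ * g (φ i))]
  refine sum_congr rfl fun z _ => ?_
  rw [blockMarg, sum_mul]
  refine sum_congr rfl fun φ hφ => ?_
  rw [(mem_filter.mp hφ).2]

/-- Block marginals preserve total mass. [folklore] -/
theorem sum_blockMarg (p : (Fin m → Z) → ℝ) (i : Fin m) : ∑ z, blockMarg p i z = ∑ φ, p φ := by
  have h := sum_mul_apply_eq_sum_blockMarg p i (fun _ => 1)
  simp only [mul_one] at h
  exact h.symm

/-- Block marginals of a positive law are positive. [folklore] -/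
theorem blockMarg_pos {p : (Fin m → Z) → ℝ} (hp : ∀ φ, 0 < p φ) (i : Fin m) (z : Z) :
    0 < blockMarg p i z := by
  classical
  have hne : (univ.filter (fun φ : Fin m → Z => φ i = z)).Nonempty :=
    ⟨Function.update (fun _ => z) i z, by simp⟩
  exact sum_pos (fun φ _ => hp φ) hne

/-- `Σ_φ p φ log(blockProd qb φ) = Σ_i Σ_z p_i z log (qb i z)`. [folklore] -/
theorem sum_mul_log_blockProd (p : (Fin m → Z) → ℝ) {qb : Fin m → Z → ℝ}
    (hq : ∀ i z, 0 < qb i z) :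
    ∑ φ, p φ * Real.log (blockProd qb φ) = ∑ i, ∑ z, blockMarg p i z * Real.log (qb i z) := by
  unfold blockProd
  have h1 : ∀ φ : Fin m → Z, Real.log (∏ i, qb i (φ i)) = ∑ i, Real.log (qb i (φ i)) :=
    fun φ => Real.log_prod fun i _ => (hq i (φ i)).ne'
  simp_rw [h1, mul_sum]
  rw [sum_comm]
  exact sum_congr rfl fun i _ => sum_mul_apply_eq_sum_blockMarg p i (fun z => Real.log (qb i z))

/-- **Chain rule over `m` blocks**: `D(p ‖ ⊗qb) = D(p ‖ ⊗p_i) + Σ_i D(p_i ‖ qb_i)`. [folklore] -/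
theorem klFin_blockProd_eq {p : (Fin m → Z) → ℝ} (hp : ∀ φ, 0 < p φ) {qb : Fin m → Z → ℝ}
    (hq : ∀ i z, 0 < qb i z) :
    klFin p (blockProd qb) =
      klFin p (blockProd (blockMarg p)) + ∑ i, klFin (blockMarg p i) (qb i) := by
  have hpm : ∀ i z, 0 < blockMarg p i z := blockMarg_pos hp
  have e1 : klFin p (blockProd qb) =
      ∑ φ, p φ * Real.log (p φ) - ∑ φ, p φ * Real.log (blockProd qb φ) := by
    unfold klFin
    rw [← sum_sub_distrib]
    exact sum_congr rfl fun φ _ => by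
      rw [Real.log_div (hp φ).ne' (blockProd_pos hq φ).ne']; ring
  have e2 : klFin p (blockProd (blockMarg p)) =
      ∑ φ, p φ * Real.log (p φ) - ∑ φ, p φ * Real.log (blockProd (blockMarg p) φ) := by
    unfold klFin
    rw [← sum_sub_distrib]
    exact sum_congr rfl fun φ _ => by
      rw [Real.log_div (hp φ).ne' (blockProd_pos hpm φ).ne']; ring
  have e3 : ∑ i, klFin (blockMarg p i) (qb i) =
      ∑ i, ∑ z, blockMarg p i z * Real.log (blockMarg p i z) -
        ∑ i, ∑ z, blockMarg p i z * Real.log (qb i z) := by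
    rw [← sum_sub_distrib]
    refine sum_congr rfl fun i _ => ?_
    unfold klFin
    rw [← sum_sub_distrib]
    exact sum_congr rfl fun z _ => by
      rw [Real.log_div (hpm i z).ne' (hq i z).ne']; ring
  rw [e1, e2, e3, sum_mul_log_blockProd p hq, sum_mul_log_blockProd p hpm]
  ring

/-- **T2-I (VolumeScalingOfTraining, provable core).**  If the model factorises over `m` blocks
and every block marginal of the target is at total-variation distance `≥ δ` from the model's
block factor, then `D_KL(p ‖ q) ≥ m · 2δ²`. [folklore] -/
theorem blockDefect_volume_law {p : (Fin m → Z) → ℝ} (hp : ∀ φ, 0 < p φ) (hp1 : ∑ φ, p φ = 1)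
    {qb : Fin m → Z → ℝ} (hq : ∀ i z, 0 < qb i z) (hq1 : ∀ i, ∑ z, qb i z = 1) {δ : ℝ}
    (hδ : 0 ≤ δ) (hdef : ∀ i, δ ≤ tvDist (blockMarg p i) (qb i)) :
    (m : ℝ) * (2 * δ ^ 2) ≤ klFin p (blockProd qb) := by
  have hpm : ∀ i z, 0 < blockMarg p i z := blockMarg_pos hp
  have hpm1 : ∀ i, ∑ z, blockMarg p i z = 1 := fun i => by rw [sum_blockMarg, hp1]
  rw [klFin_blockProd_eq hp hq]
  have hI : 0 ≤ klFin p (blockProd (blockMarg p)) := by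
    refine klFin_nonneg (fun φ => (hp φ).le) (blockProd_pos hpm) ?_
    rw [sum_blockProd, hp1]
    simp_rw [hpm1]
    simp
  have hblock : ∀ i, 2 * δ ^ 2 ≤ klFin (blockMarg p i) (qb i) := by
    intro i
    have hpin := two_mul_tvDist_sq_le_kl (hpm i) (hq i) (hpm1 i) (hq1 i)
    have hsq : δ ^ 2 ≤ tvDist (blockMarg p i) (qb i) ^ 2 := pow_le_pow_left₀ hδ (hdef i) 2
    unfold klFin
    linarith
  have hsum : (m : ℝ) * (2 * δ ^ 2) ≤ ∑ i, klFin (blockMarg p i) (qb i) := by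
    have := sum_le_sum fun i (_ : i ∈ (univ : Finset (Fin m))) => hblock i
    simpa using this
  linarith

end Blocks

/-- **T2-I (VolumeScalingOfTraining, provable core) — PROVED (`blockDefectVolumeLaw`).**  If the
MODEL is independent across `m` blocks (`q(φ) = Π_i qb i (φ i)`, which T2-G supplies for blocks
separated by twice the flow's range) and on every block the target's marginal is at
total-variation distance `≥ δ` from the model's, then `D_KL(p‖q) ≥ m·2δ²` (chain rule over the
blocks + sharp Pinsker per block), hence by T2-A `ESS/N ≤ exp(−2δ² m)`: exponential in the number
of blocks, i.e. in the volume at fixed block size.  The physics input "δ > 0 uniformly in the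
volume" (a connected correlation of `p` across the gap inside each block that an
across-gap-independent `q` cannot reproduce) is THEORY-2.md's hypothesis (U); it is a theorem at
strong coupling (cluster expansion) and numerically evident elsewhere. [folklore] -/
def BlockDefectVolumeLaw : Prop :=
  ∀ (m : ℕ) (Z : Type) [Fintype Z] [DecidableEq Z] (p : (Fin m → Z) → ℝ)
    (qb : Fin m → Z → ℝ) (δ : ℝ),
    (∀ φ, 0 < p φ) → ∑ φ, p φ = 1 → (∀ i z, 0 < qb i z) → (∀ i, ∑ z, qb i z = 1) → 0 ≤ δ →
    (∀ i, δ ≤ tvDist (fun z => ∑ φ ∈ univ.filter (fun φ => φ i = z), p φ) (qb i)) →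
    (m : ℝ) * (2 * δ ^ 2) ≤ klFin p (fun φ => ∏ i, qb i (φ i))

/-- T2-I holds (`blockDefect_volume_law`). [folklore] -/
theorem blockDefectVolumeLaw : BlockDefectVolumeLaw :=
  fun _ _ _ _ _ _ _ hp hp1 hq hq1 hδ hdef => blockDefect_volume_law hp hp1 hq hq1 hδ hdef

/-- **T2-I″ (ESS form of the block-defect volume law; proved).**  T2-I composed with T2-A:
`m` model-independent blocks with per-block total-variation defect `≥ δ` force
`ESS/N ≤ exp(−2 m δ²)` for ANY target `p` (not necessarily factorised). [folklore] -/
theorem ess_blockDefect_volume_law {m : ℕ} {Z : Type*} [Fintype Z] [DecidableEq Z]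
    {p : (Fin m → Z) → ℝ} (hp : ∀ φ, 0 < p φ) (hp1 : ∑ φ, p φ = 1)
    {qb : Fin m → Z → ℝ} (hq : ∀ i z, 0 < qb i z) (hq1 : ∀ i, ∑ z, qb i z = 1) {δ : ℝ}
    (hδ : 0 ≤ δ) (hdef : ∀ i, δ ≤ tvDist (blockMarg p i) (qb i)) :
    essFrac p (blockProd qb) ≤ Real.exp (-((m : ℝ) * (2 * δ ^ 2))) :=
  (essFrac_le_exp_neg_kl hp (blockProd_pos hq) hp1).trans
    (Real.exp_le_exp.2 (neg_le_neg (blockDefect_volume_law hp hp1 hq hq1 hδ hdef)))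

end Summit.Ventures.LatticeQCDFlow.Theory2
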